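import Literature.NumberTheory.LFunctions.KMVPrimeAveragedSecondSqueeze
import Literature.NumberTheory.LFunctions.KMVDiagonalSlack

/-!
# Route `PrimeLevelFamEdge`, crux K_B `BeyondDiagonalBeatsQuarter` (stmt-Parity-20343): the registered
# heart S2u of the line `birth` FROM the prime-averaged second-defect stub A of the line
# `prime-averaged-squeeze` (D-0130) — the «5-line composition» of the tenure ruling, kernel-checked

The crux item's single-slot stub registry holds the line `birth` (rev 6): D (landed), Pt′ (printed, the
repaired Petersson bound) and the HEART S2u `stub_secondCorrectionUpperSomewhere` — for every window
`(1, Δ]` and every MA-consistent `(T₁, T₂)`, on SOME sub-window `(a, b) ⊆ [1, min Δ 2]` with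
`a < 3/2`, `secondMomentForm Δ' X² 1 + T₂ Δ' X² 1 < 2·(linForm Δ' X² 1)²`. The second line on the same
crux, `prime-averaged-squeeze` (ls-Bfam-prover-2, cell decision D-0130), has ONE analytic stub A
`stub_primeAveragedSecondDiagOnlyXSq`: on some `(1, b)` the SECOND defect at `(X², 1)` is `o(1)` on
average over the good primes of dyadic blocks. The tenure ruling (ls-Bfam-plan g5, 2026-08-27T12:46:52Z)
records that A implies S2u by landed lemmas; this file IS that composition as one theorem, so that a
proof of A is credited against the registered S2u by `fun hA ↦ upperSomewhere_X_sq_of_primeAveragedSecondDiagOnly hA`: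
A and the window's `MomentAsymptotics` pin `T₂ Δ' X² 1 = 0` on `(1, min Δ (min b 2))`
(`KMV2000.T₂_eq_zero_of_secondDefect_average_of_le_two`, p531103), and then
`second + T₂ = 4 + 4/Δ' < 8 = 2·lin²` for `Δ' > 1` (`KMV2000.secondMomentForm_X_sq_one`,
`linForm_X_sq_one`). Both signatures are in the KMV vocabulary (no route decl), so the file imports
Literature only. Neither A nor S2u is asserted (both OPEN; A is priced by ls-ref-1's line pre-read
2026-08-27T12:54:26Z as overstated relative to need — its signed/one-sided variants A′/A″ would also
suffice; not typed here). Helper for the crux item; standard axioms. «The programme SEARCHES and TYPES;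
no claim about Landau–Siegel zeros, Theorems 1–2 of arXiv:2211.02515 or a repaired Margin232 until a
kernel theorem says so.»
-/

namespace Summit.Parity.GeneralizedHardyLittlewood.Theorems.BeyondDiagonalBeatsQuarter

open Polynomial
open Literature.NumberTheory.LFunctions

/-- **Stub A ⇒ S2u.** If on some length window `(1, b)` the second defect at `(X², 1)` is `o(1)` on
average over the good primes of dyadic blocks (the registered stub of the line `prime-averaged-squeeze`,
verbatim as hypothesis), then for every window `(1, Δ]` and every MA-consistent `(T₁, T₂)` the total
second main term of the profile `X²` stays strictly below `2·lin²` on the sub-window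
`(1, min Δ (min b 2)) ⊆ [1, min Δ 2]` (the registered heart S2u of the line `birth`, verbatim as
conclusion): the squeeze pins `T₂ Δ' X² 1 = 0` there and `4 + 4/Δ' < 8` for `Δ' > 1`.
[cite: KowalskiMichelVanderKam2000, §6 p. 19 (second-moment display) and Thm. 6.1 (30)–(32)] -/
theorem upperSomewhere_X_sq_of_primeAveragedSecondDiagOnly
    (hA : ∃ b : ℝ, 1 < b ∧ ∀ Δ' : ℝ, 1 < Δ' → Δ' < b → ∀ ε : ℝ, 0 < ε → ∃ N₀ : ℕ, ∀ N : ℕ, N₀ ≤ N →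
      ∑ q ∈ KMV2000.goodPrimes Δ' N, KMV2000.secondDefect (X ^ 2) 1 Δ' q ≤
        ε * (KMV2000.goodPrimes Δ' N).card) :
    ∀ Δ : ℝ, 1 < Δ → ∀ T₁ T₂ : ℝ → ℝ[X] → ℝ[X] → ℝ, KMV2000.MomentAsymptotics 1 Δ T₁ T₂ →
      ∃ a b : ℝ, 1 ≤ a ∧ a < b ∧ b ≤ min Δ 2 ∧ a < 3 / 2 ∧ ∀ Δ' : ℝ, a < Δ' → Δ' < b →
        KMV2000.secondMomentForm Δ' (X ^ 2) 1 + T₂ Δ' (X ^ 2) 1 <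
          2 * KMV2000.linForm Δ' (X ^ 2) 1 ^ 2 := by
  obtain ⟨b, hb, hav⟩ := hA
  intro Δ hΔ T₁ T₂ hMA
  refine ⟨1, min Δ (min b 2), le_rfl, lt_min hΔ (lt_min hb (by norm_num)),
    min_le_min le_rfl (min_le_right _ _), by norm_num, fun Δ' h1 h2 ↦ ?_⟩
  have hΔ'Δ : Δ' ≤ Δ := h2.le.trans (min_le_left _ _)
  have hΔ'b : Δ' < b := lt_of_lt_of_le h2 ((min_le_right _ _).trans (min_le_left _ _))
  have hΔ'2 : Δ' < 2 := lt_of_lt_of_le h2 ((min_le_right _ _).trans (min_le_right _ _))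
  have hΔ'0 : 0 < Δ' := by linarith
  have hT₂ : T₂ Δ' (X ^ 2) 1 = 0 :=
    KMV2000.T₂_eq_zero_of_secondDefect_average_of_le_two hMA KMV2000.admissible_X_sq
      KMV2000.isEvenOrOdd_one h1 hΔ'Δ hΔ'0 hΔ'2.le (hav Δ' h1 hΔ'b)
  rw [hT₂, add_zero, KMV2000.secondMomentForm_X_sq_one, KMV2000.linForm_X_sq_one]
  have h4 : 4 / Δ' < 4 := by
    rw [div_lt_iff₀ hΔ'0]
    linarith
  linarith

end Summit.Parity.GeneralizedHardyLittlewood.Theorems.BeyondDiagonalBeatsQuarter
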